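import Summits.BirchSwinnertonDyer.BirchSwinnertonDyer.Theorems.SchneiderFreeAdditiveX3AnticycControlAdditiveCoinvAnyTorsion
import Summits.BirchSwinnertonDyer.BirchSwinnertonDyer.Theorems.SchneiderFreeAdditiveX3AnticycControlAdditiveTorsionExponents
import Summits.BirchSwinnertonDyer.BirchSwinnertonDyer.Theorems.SchneiderFreeAdditiveX3AnticycControlAdditiveLocalKernelAtP
import Summits.BirchSwinnertonDyer.Rank1Residual.X2.MultControlNoPadicTorsion
import Literature.NumberTheory.EllipticCurves.IwasawaTowerTorsionProofs
import Literature.NumberTheory.EllipticCurves.AnticyclotomicPrimeDecompositionAboveProofs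
import HarnessLib

/-!
# Crux 4 `BSDpOnCellC` (stmt-BirchSwinnertonDyer-19034), line b1, stub `stub_ctlOrSwitch` — CTL-loc:
# the anticyclotomic control theorem `X2.SplitControlOnTree` at a split Eisenstein `p ‖ N` WITH LOCAL
# `p`-TORSION, from `E(K)[p] = 0` and Fin_v (cell `bsd-eis`, seat `bsd-eis-k5-c4` g5; THEOREMS ONLY,
# `--supports stmt-BirchSwinnertonDyer-19034`)

HONEST FRAMING (cell `bsd-eis`, run/shared/lean/pub/bsd-eis/): theorems only; nothing booked; X2
stays CONSTRUCTION-SHAPED; no label or count moves; closes nothing by itself. CONDITIONAL on the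
cited Poitou–Tate facts / GZK / modularity / Brink exactly as the tree's
`X2.splitControlOnTree_of_cellC_of_noPadicPTorsion` (hypotheses BY NAME), on `E(K)[p] = 0` at every
CGLS field, and on Fin_v (finiteness of `E(K_{∞,w})[p^∞]` above `𝔭`).

## Why this file (k5-c4-MEMO-2 §0 C3/C4: the torsion residual of `stub_ctlOrSwitch` is CTL-loc)

The registered stub `stub_ctlOrSwitch` of skeleton b1 v8 asks, at a split X2c pair, for
`X2.SplitControlOnTree W p` OR an étale switch to an isogenous `W′` with `W′(ℚ_p)[p] = 0` (where control
is the THEOREM `X2.splitControlOnTree_of_cellC_of_noPadicPTorsion`). Its residual (14/543 window classes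
@3, cgshw MEMO-11) is the END of the ℚ-rational étale chain: a curve with `W′(ℚ_p)[p] ≠ 0` but — chain-end
lemma, k5-c4 g4, `EtaleChainEnd.forall_torsion_eq_zero_of_no_etaleLine_of_odd` — `W′(K)[p] = 0` for
EVERY imaginary quadratic `K` with `p` split. This file proves the control theorem THERE: the X2 twin of
the `bsd-schneider-ideate` cell's torsion-robust control EQUALITY for the additive door
(`SchneiderFreeAdditiveX3.additiveControlOnTreeAt_of_torsAtoms` and its atom dischargers, seats
door-c4/c5/c6), whose cohomological atoms are reduction-type-free and are imported VERBATIM: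

* `natCard_ker_resOfLe_top_eq_one_of_noKTorsion` — (KER-res) with exponent `g = 0`:
  `E(K)[p] = 0 ⟹ ker (H¹(K, E[p^∞]) → H¹(K_∞, E[p^∞])) = 0` (Greenberg Lemma 4.3 bookkeeping).
* **`controlOnTreeAt_of_torsAtoms`** — `X11b.ControlOnTreeAt p κ 𝔭 γ ι P` (Cas18 Thm. 2.3 shape, X2
  currency `2((ord_p log_ω P − 1) − ord_p idx)`) from (KER-res) `p^g`, (KER-𝔭) `#ker r_𝔭 = p^t`, the
  base count `#Sel_𝔭(K, E[p^∞]) = p^a`, `a = ord_p #Ш + 2((ord_p log P − 1) − ord_p idx) + ord_p ∏_{w∣p}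
  c_w + g − t`, (P9-𝓒), (L10), (P11) — the exact counting snake lemma
  `natCard_endInvariants_mul_natCard_resKer_eq_nPlus` (door-c4): `g` and `t` CANCEL.
* **`controlOnTreeAt_of_cellC_of_noKTorsion_of_finV`** — at a CGLS datum of a multiplicative rank-one
  pair: `E(K)[p] = 0` (NOT `E(ℚ_p)[p] = 0`) + Fin_v `LocalTowerTorsionFiniteAt (E_K) p κ 𝔭` + the cited
  facts ⟹ `ControlOnTreeAt`. Dischargers: `g = 0` (above); `t = ord_p #E(ℚ_p)[p^∞]` by door-c4's
  `natCard_localKer_eq_pow_of_finite` (Fin_v + Brink Cor. 1 at the prime above `p`, tree THEOREM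
  `decomp_not_le_kerSubgroup_above_of_isAnticyclotomic_holds`); the base count is the X2 tree theorem
  `X2.natCard_selmerAcBase_mul_eq_of_rankOne_of_noTorsion` (`#Sel · #E(ℚ_p)[p^∞] = p^a`, hypothesis
  `E(K)[p] = 0` only); (P9-𝓒) `ptSurj_of_finite` and (L10) `coinvariantsTrivialAt_of_finite_anyTorsion`
  (door-c6, no torsion hypothesis); (P11) `r1LocalKernelOrderAt_of_anticyclotomicDecomposition`.
* **`splitControlOnTree_of_cellC_of_noKTorsion_of_finV`** — `CellC W p → p ≠ 2 → [E(K)[p] = 0 at every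
  imaginary quadratic K with p split] → [Fin_v at every anticyclotomic frame] → SplitControlOnTree W p`.

What is NOT here: Fin_v at a split multiplicative `p` (the next file of this seat: the Tate line at
`(K, 𝔭)` + Brink ⟹ `E(K_{∞,w})[p^∞] = E(K_𝔭)[p^∞]`, finite), and the composition with the chain-end
lemma (`… of_noEtaleLine`). Under (iv) `E(ℚ_p)[p] = 0` both hypotheses are tree theorems and this file
specialises to cgshw g8's `X2.splitControlOnTree_of_cellC_of_noPadicPTorsion`.

References: [JetchevSkinnerWan2017] Thm. 3.3.1, Prop. 3.2.1, Prop. 3.3.2, Lemma 3.3.3, Prop. 3.3.4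
(arXiv:1512.06894 pp. 10–13); [Castella2018] Thm. 2.3 (arXiv:1704.06608 p. 5); [GreenbergLNM1716] §3
pp. 85–90, §4 Lemma 4.3; [Brink2007] Thm. 2, Cor. 1; [KellerYin2024] App. B Thm. B.0.6 (printed template
of control with torsion); k5-c4-MEMO-2; cgshw MEMO-7 §2c (I1)–(I6), MEMO-11.
-/

set_option autoImplicit false
-- the route's Theorems namespace `Summit.BirchSwinnertonDyer.BirchSwinnertonDyer.Theorems` (summit = problem) trips the linter
set_option linter.dupNamespace false

noncomputable section

open scoped Classical

open WeierstrassCurve NumberField IsDedekindDomain Field Literature.NumberTheory.EllipticCurves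
  Literature.NumberTheory.EllipticCurves.ModularForms
  Literature.NumberTheory.EllipticCurves.GreenbergSelmer
  Literature.NumberTheory.GaloisRepresentations Literature.NumberTheory.GaloisCohomology
  Literature.NumberTheory.EllipticCurves.Rank1Residual
  Literature.NumberTheory.EllipticCurves.Rank1Residual.Typed
  Literature.NumberTheory.Automorphic
  Summit.BirchSwinnertonDyer.Rank1Residual
  Summit.BirchSwinnertonDyer.Rank1Residual.X11b
  Summit.BirchSwinnertonDyer.Rank1Residual.X11b.AcSelmer
  Summit.BirchSwinnertonDyer.Rank1Residual.X11b.LocBridge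
  Summit.BirchSwinnertonDyer.Rank1Residual.X2
  Summit.BirchSwinnertonDyer.BirchSwinnertonDyer.Theorems.SchneiderFreeControlAtoms
  Summit.BirchSwinnertonDyer.BirchSwinnertonDyer.Theorems.SchneiderFreeAdditiveX3

namespace Summit.BirchSwinnertonDyer.BirchSwinnertonDyer.Theorems.CtlLoc

/-! ## §1. (KER-res) with exponent `g = 0` under `E(K)[p] = 0` -/

section KerRes

variable {K : Type} [Field K] [NumberField K] (W : WeierstrassCurve K) [W.IsElliptic] (p : ℕ)
  [Fact p.Prime] (κ : ZpExtension K p)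

/-- **(KER-res) with exponent `g = 0`: `E(K)[p] = 0 ⟹ #ker (H¹(K, E[p^∞]) → H¹(K_∞, E[p^∞])) = 1`**
(Greenberg's Lemma 4.3 bookkeeping `#ker h₀ = #E(K)[p^∞]`, door-c4's
`natCard_ker_resOfLe_top_eq_natCard_fixedPoints`, with `E(K_∞)[p^∞] = 0` and `E[p^∞]^{Γ_K} = 0` both
from `E(K)[p] = 0`, tree `IwasawaTowerTorsionProofs`). [cite: GreenbergLNM1716, §4 Lemma 4.3 (p. 103)] -/
theorem natCard_ker_resOfLe_top_eq_one_of_noKTorsion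
    (hK : ∀ P : W.toAffine.Point, p • P = 0 → P = 0) :
    Nat.card (W.resOfLe p (le_top : κ.kerSubgroup ≤ ⊤)).ker = 1 := by
  haveI := W.finite_fixedPoints_kerSubgroup_geomPrimaryTorsion κ hK
  rw [natCard_ker_resOfLe_top_eq_natCard_fixedPoints W p κ, Nat.card_eq_one_iff_unique]
  have key : ∀ c : {m : geomPrimaryTorsion W p | ∀ σ : absoluteGaloisGroup K, σ • m = m},
      (c : geomPrimaryTorsion W p) = 0 := fun c ↦ W.eq_zero_of_forall_smul_eq hK c.2
  exact ⟨⟨fun a b ↦ Subtype.ext ((key a).trans (key b).symm)⟩, ⟨⟨0, fun σ ↦ smul_zero σ⟩⟩⟩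

end KerRes

/-! ## §2. The torsion-robust count in X2 currency: `ControlOnTreeAt` from the atoms -/

section TorsAtoms

variable {W : WeierstrassCurve ℚ} [W.IsElliptic] [W.IsGloballyMinimal] {K : Type} [Field K]
  [NumberField K] {p : ℕ} [Fact p.Prime] {κ : ZpExtension K p}

/-- **`X11b.ControlOnTreeAt` (Cas18 Thm. 2.3 shape at `p ∣ N`) FROM THE TORSION-ROBUST ATOMS — the X2
twin of door-c4's `additiveControlOnTreeAt_of_torsAtoms`.** For `K` imaginary quadratic with `p` split
and `p ∣ N_E`, an anticyclotomic `κ` with topological generator `γ`, a prime `𝔭 ∣ p`, any `ι`, `P`, and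
natural numbers `g, t, a`: IF (KER-res) `#ker(H¹(K, E[p^∞]) → H¹(K_∞, E[p^∞])) = p^g`, (KER-𝔭)
`#ker r_𝔭 = p^t`, (P6-tors) Castella's Selmer group over `K` has order `p^a` with
`a = ord_p #Ш(E/K)[p^∞] + 2((ord_p log_ω P − 1) − ord_p[E(K):ℤP]) + ord_p ∏_{w∣p} c_w(E/K) + g − t`,
(P9-𝓒) the Poitou–Tate surjectivity `hloc`, (L10) `CoinvariantsTrivialAt` and (P11) `LocalKernelOrderAt`
at every `w ∈ Σ(N⁺)`, THEN `ControlOnTreeAt p κ 𝔭 γ ι P`: the exponents `g` and `t` CANCEL (exact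
counting snake lemma `natCard_endInvariants_mul_natCard_resKer_eq_nPlus`). With `g = t = 0` this is
cgshw g8's `X2.controlOnTreeAt_of_atoms_of_noPadicPTorsion`.
[cite: JetchevSkinnerWan2017, Thm. 3.3.1 and Prop. 3.2.1 (arXiv:1512.06894 pp. 10–11)]
[cite: Castella2018, Thm. 2.3 (arXiv:1704.06608 p. 5)] [cite: GreenbergLNM1716, §3 p. 90] -/
theorem controlOnTreeAt_of_torsAtoms (hK : IsImaginaryQuadratic K) (hsplit : SplitsIn K p)
    (hpN : p ∣ W.conductorNorm ℤ) (hκ : κ.IsAnticyclotomic)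
    (γ : absoluteGaloisGroup K) [hγ : Fact (κ.IsTopGenerator γ)] (𝔭 : HeightOneSpectrum (𝓞 K))
    (h𝔭 : ((p : ℕ) : 𝓞 K) ∈ 𝔭.asIdeal) (ι : K →+* ℚ_[p]) (P : (W.baseChange K).toAffine.Point)
    (g t a : ℕ)
    (hres : Nat.card ((W.baseChange K).resOfLe p (le_top : κ.kerSubgroup ≤ ⊤)).ker = p ^ g)
    (h𝔭ker : Nat.card (localKer κ.kerSubgroup ((W.baseChange K).geomPrimaryTorsion p) 𝔭) = p ^ t)
    (h6 : (∃ _ : Finite (selmerAcBase (W.baseChange K) p 𝔭 ∅),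
        Nat.card (selmerAcBase (W.baseChange K) p 𝔭 ∅) = p ^ a) ∧
      (a : ℤ) = (padicValNat p
          (Nat.card (AddCommGroup.primaryComponent (W.baseChange K).sha p)) : ℤ) +
        2 * ((X11b.padicLogOrd W p ι P - 1) - (padicValNat p (AddSubgroup.zmultiples P).index : ℤ)) +
          padicValNat p (tamagawaProductAbove W K p) + g - t)
    (hloc : ∀ x : Π v : ↥(insert 𝔭 (nPlusPlaces_finite (W := W) (p := p) (K := K) hK.1).toFinset),
        Literature.NumberTheory.EllipticCurves.subgroupH1
          ((⊤ : Subgroup (absoluteGaloisGroup K)) ⊓ decomp (v : HeightOneSpectrum (𝓞 K)))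
          ((W.baseChange K).geomPrimaryTorsion p),
      (∀ v : ↥(insert 𝔭 (nPlusPlaces_finite (W := W) (p := p) (K := K) hK.1).toFinset),
        x v ∈ localKer κ.kerSubgroup ((W.baseChange K).geomPrimaryTorsion p)
          (v : HeightOneSpectrum (𝓞 K))) →
        ∃ c : (W.baseChange K).subgroupH1 p (⊤ : Subgroup (absoluteGaloisGroup K)),
          locAtFinset (W.baseChange K) p _ c = x ∧
          ∀ v : HeightOneSpectrum (𝓞 K), ((p : ℕ) : 𝓞 K) ∉ v.asIdeal → v ∉ (∅ : Set _) →
            v ∉ insert 𝔭 (nPlusPlaces_finite (W := W) (p := p) (K := K) hK.1).toFinset →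
              c ∈ awayKer ⊤ ((W.baseChange K).geomPrimaryTorsion p) v)
    (h10 : CoinvariantsTrivialAt (W.baseChange K) p κ 𝔭 γ)
    (h11 : ∀ v ∈ nPlusPlaces W K p, LocalKernelOrderAt (W.baseChange K) p κ v) :
    ControlOnTreeAt p κ 𝔭 γ ι P := by
  have hp : p.Prime := Fact.out
  haveI : IsTotallyComplex K := hK.2
  obtain ⟨⟨hfinK, hcardK⟩, ha⟩ := h6
  haveI := hfinK
  have hfin𝔭 : Finite (localKer κ.kerSubgroup ((W.baseChange K).geomPrimaryTorsion p) 𝔭) :=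
    Nat.finite_of_card_ne_zero (by rw [h𝔭ker]; exact pow_ne_zero _ hp.ne_zero)
  have hfin : ∀ v ∈ nPlusPlaces W K p,
      Finite (localKer κ.kerSubgroup ((W.baseChange K).geomPrimaryTorsion p) v) :=
    fun v hv ↦ (h11 v hv).1
  obtain ⟨hfinγ, _, hcount⟩ := natCard_endInvariants_mul_natCard_resKer_eq_nPlus (W := W) hK hκ γ 𝔭
    h𝔭 hfin𝔭 hfin hloc
  -- the local kernels at `Σ(N⁺)` are the Tamagawa `p`-parts
  have hprod : (∏ v ∈ (nPlusPlaces_finite (W := W) (p := p) (K := K) hK.1).toFinset,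
      Nat.card (localKer κ.kerSubgroup ((W.baseChange K).geomPrimaryTorsion p) v)) =
        p ^ ∑ v ∈ (nPlusPlaces_finite (W := W) (p := p) (K := K) hK.1).toFinset, padicValNat p
          (((W.baseChange K).baseChange (v.adicCompletion K)).localTamagawaNumber
            (v.adicCompletionIntegers K)) := by
    rw [← Finset.prod_pow_eq_pow_sum]
    refine Finset.prod_congr rfl fun v hv => ?_
    obtain ⟨_, hv'⟩ := h11 v ((nPlusPlaces_finite (W := W) (p := p) hK.1).mem_toFinset.mp hv)
    exact hv'
  rw [hres, hcardK, h𝔭ker, hprod, ← pow_add, ← pow_add] at hcount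
  -- `#Sel^γ · p^g = p^m`, `m = a + (t + Σ ord_p c_w)`, hence `#Sel^γ = p^(m - g)`
  obtain ⟨m, hm, hcount⟩ : ∃ m : ℕ, m = a + (t + ∑ v ∈ (nPlusPlaces_finite (W := W) (p := p)
      (K := K) hK.1).toFinset, padicValNat p
        (((W.baseChange K).baseChange (v.adicCompletion K)).localTamagawaNumber
          (v.adicCompletionIntegers K))) ∧
      Nat.card (IwasawaDual.endInvariants (conjSelmerAc (W.baseChange K) p κ 𝔭 ∅ γ - 1)) * p ^ g =
        p ^ m := ⟨_, rfl, hcount⟩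
  have hle : g ≤ m := by
    have hdvd : p ^ g ∣ p ^ m := ⟨_, by rw [mul_comm]; exact hcount.symm⟩
    exact (Nat.pow_dvd_pow_iff_le_right hp.one_lt).mp hdvd
  have hcardγ : Nat.card (IwasawaDual.endInvariants
      (conjSelmerAc (W.baseChange K) p κ 𝔭 ∅ γ - 1)) = p ^ (m - g) := by
    have hsplitpow : p ^ m = p ^ (m - g) * p ^ g := by
      rw [← pow_add, Nat.sub_add_cancel hle]
    rw [hsplitpow] at hcount
    exact Nat.eq_of_mul_eq_mul_right (pow_pos hp.pos g) hcount
  have hcoinv := natCard_endCoinvariants_eq_one_of_surjective _ h10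
  rw [controlOnTreeAt_iff_card p κ 𝔭 γ ι P]
  refine ⟨m - g, ⟨hfinγ, ?_⟩, ?_⟩
  · rw [hcardγ, hcoinv, mul_one]
  · rw [Nat.cast_sub hle, hm, Nat.cast_add, Nat.cast_add, ha,
      padicValNat_tamagawaProductSplit_eq_above_add_sum W p hK.1 hsplit hpN]
    push_cast
    ring

end TorsAtoms

/-! ## §3. CTL-loc at a datum: `E(K)[p] = 0` + Fin_v + the cited facts -/

section Datum

variable (W : WeierstrassCurve ℚ) [W.IsElliptic] [W.IsGloballyMinimal] (p : ℕ) [Fact p.Prime]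

/-- **CTL-loc at a CGLS datum.** For `E/ℚ` globally minimal of analytic rank one with MULTIPLICATIVE
reduction at the odd prime `p`, an imaginary quadratic `K` with `p` split and `L(E^{(d_K)}, 1) ≠ 0`,
`P ∈ E(K)` of infinite order, an ANTICYCLOTOMIC `κ` with topological generator `γ` and a degree-one
`𝔭 ∣ p`: IF `E(K)[p] = 0` (`hivK0` — NOT `E(ℚ_p)[p] = 0`) and Fin_v holds at `𝔭` (`E(K_{∞,w})[p^∞]`
finite, `LocalTowerTorsionFiniteAt`), THEN `ControlOnTreeAt p κ 𝔭 γ (embAt K p 𝔭) P`, from GZK /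
modularity and the cited cohomological facts (Poitou–Tate duality for Selmer structures and for `Ш`,
Brink Thm. 2). The X2 twin of cgshw g8's `X2.controlOnTreeAt_of_noPadicPTorsion_of_rankOne`
(hypothesis `h0 : E(ℚ_p)[p] = 0` weakened to `E(K)[p] = 0` + Fin_v; Milne I 2.8, `cd_p ≤ 2` and Brink
Cor. 1 above `p` are tree theorems now). CONDITIONAL on the cited facts; nothing booked.
[cite: Castella2018, Thm. 2.3 (arXiv:1704.06608 p. 5)] [cite: JetchevSkinnerWan2017, Thm. 3.3.1, Prop. 3.2.1, Prop. 3.3.2, Lemma 3.3.3, Prop. 3.3.4 (arXiv:1512.06894 pp. 10–13)]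
[cite: Brink2007, Thm. 2 and Cor. 1 (pp. 2134–2136)] [cite: GreenbergLNM1716, §3 Lemma 3.3 (p. 87), p. 90] -/
theorem controlOnTreeAt_of_cellC_of_noKTorsion_of_finV
    (hGZK : rank_eq_analyticRank_of_analyticRank_le_one) (hnf : exists_isNewformOf)
    (hPT : ∀ (K : Type) [Field K] [NumberField K], poitouTate_selmerStructure_duality K)
    (hPT2 : ∀ (K : Type) [Field K] [NumberField K], poitouTate_sha_tateDual K)
    (hEP : ∀ (K : Type) [Field K] [NumberField K] (v : HeightOneSpectrum (𝓞 K)),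
      localEulerPoincareCharacteristic (v.adicCompletion K))
    (hBr : ∀ (K : Type) [Field K] [NumberField K] (p : ℕ) [Fact p.Prime],
      ZpExtension.decomp_not_le_kerSubgroup_of_isAnticyclotomic K p)
    (hp2 : p ≠ 2) (hmult : Mult W p) (hr : W.analyticRank = 1)
    {K : Type} [Field K] [NumberField K] (hK : IsImaginaryQuadratic K) (hsplit : SplitsIn K p)
    (hivK0 : ∀ Q : (W.baseChange K).toAffine.Point, p • Q = 0 → Q = 0)
    (hLt : (W.quadraticTwist (NumberField.discr K : ℚ)).entireLFunction 1 ≠ 0)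
    (P : (W.baseChange K).toAffine.Point) (hPinf : ¬ IsOfFinAddOrder P)
    (κ : ZpExtension K p) (hκ : κ.IsAnticyclotomic) (γ : absoluteGaloisGroup K)
    [hγ : Fact (κ.IsTopGenerator γ)] (𝔭 : HeightOneSpectrum (𝓞 K))
    (h𝔭 : ((p : ℕ) : 𝓞 K) ∈ 𝔭.asIdeal) (he : 𝔭.asIdeal.ramificationIdx (𝓞 ℚ) = 1)
    (hf : 𝔭.asIdeal.inertiaDeg (𝓞 ℚ) = 1)
    (hFin : LocalTowerTorsionFiniteAt (W.baseChange K) p κ 𝔭) :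
    ControlOnTreeAt p κ 𝔭 γ (embAt K p 𝔭 h𝔭 he hf) P := by
  have hp : p.Prime := Fact.out
  haveI : IsTotallyComplex K := hK.2
  haveI hEK : (W.baseChange K).IsElliptic := by rw [baseChange]; infer_instance
  have hpN : p ∣ W.conductorNorm ℤ := dvd_conductorNorm_of_mult hmult
  obtain ⟨hrank, hSha⟩ := mordellWeilRank_eq_one_and_shaFinite_of_twist W hGZK hnf hr hK.1 hLt
  -- (P6') at every degree-one prime above `p`: finiteness, and the torsion-weighted count at `𝔭`
  have hfin : ∀ v : HeightOneSpectrum (𝓞 K), ((p : ℕ) : 𝓞 K) ∈ v.asIdeal →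
      Finite (selmerAcBase (W.baseChange K) p v ∅) := fun v hv ↦ by
    obtain ⟨he', hf'⟩ := degreeOne_of_splitsIn hK.1 hsplit hv
    obtain ⟨hfinv, -, -, -⟩ := X2.natCard_selmerAcBase_mul_eq_of_rankOne_of_noTorsion W p K (hPT K)
      (hEP K) hmult hivK0 hK hsplit hrank hSha P hPinf v hv he' hf'
    exact hfinv
  obtain ⟨hfinSel, a, hcard, ha⟩ := X2.natCard_selmerAcBase_mul_eq_of_rankOne_of_noTorsion W p K
    (hPT K) (hEP K) hmult hivK0 hK hsplit hrank hSha P hPinf 𝔭 h𝔭 he hf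
  -- `#E(ℚ_p)[p^∞] = p^t`, `#Sel = p^(a - t)`, `t ≤ a`
  obtain ⟨t, ht⟩ := exists_natCard_primaryComponent_padic_eq_pow W p
  have hSelpos : 0 < Nat.card (selmerAcBase (W.baseChange K) p 𝔭 ∅) := by
    haveI := hfinSel; exact Nat.card_pos
  have hta : t ≤ a := by
    have h1 : p ^ t ∣ p ^ a := ⟨Nat.card (selmerAcBase (W.baseChange K) p 𝔭 ∅), by
      rw [mul_comm, ← ht]; exact hcard.symm⟩
    exact (Nat.pow_dvd_pow_iff_le_right hp.one_lt).mp h1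
  have hcard' : Nat.card (selmerAcBase (W.baseChange K) p 𝔭 ∅) = p ^ (a - t) := by
    have h1 : Nat.card (selmerAcBase (W.baseChange K) p 𝔭 ∅) * p ^ t = p ^ (a - t) * p ^ t := by
      rw [← pow_add, Nat.sub_add_cancel hta, ← ht]; exact hcard
    exact Nat.eq_of_mul_eq_mul_right (pow_pos hp.pos t) h1
  -- (KER-𝔭): `#ker r_𝔭 = p^t` from Fin_v and Brink's Cor. 1 at the prime above `p`
  have hv : ¬ decomp 𝔭 ≤ κ.kerSubgroup :=
    ZpExtension.decomp_not_le_kerSubgroup_above_of_isAnticyclotomic_holds (K := K) (p := p) hK hp2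
      κ hκ 𝔭 h𝔭
  have h𝔭ker := natCard_localKer_eq_pow_of_finite W p κ 𝔭 h𝔭 he hf hFin hv ht
  -- (KER-res): `g = 0`
  have hres : Nat.card ((W.baseChange K).resOfLe p (le_top : κ.kerSubgroup ≤ ⊤)).ker = p ^ 0 := by
    rw [pow_zero]
    exact natCard_ker_resOfLe_top_eq_one_of_noKTorsion (W.baseChange K) p κ hivK0
  -- (P9-𝓒) at the conjugate prime, (L10), (P11)
  obtain ⟨σ, 𝔮, -, hne, h𝔮, -⟩ :=
    LocalIndexTransport.exists_conj_prime_of_splitsIn K p hK.1 hsplit h𝔭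
  have hloc := ptSurj_of_finite W p hK hsplit (hPT K) h𝔭 h𝔮 hne (hfin 𝔮 h𝔮) κ
  have h10 : CoinvariantsTrivialAt (W.baseChange K) p κ 𝔭 γ :=
    coinvariantsTrivialAt_of_finite_anyTorsion W p hK hsplit (hPT K) (hPT2 K) κ hγ.out h𝔭 hfin
  have h11 := r1LocalKernelOrderAt_of_anticyclotomicDecomposition W p hBr hp2 K hK κ hκ
  -- assemble
  refine controlOnTreeAt_of_torsAtoms hK hsplit hpN hκ γ 𝔭 h𝔭 (embAt K p 𝔭 h𝔭 he hf) P 0 t (a - t)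
    hres h𝔭ker ⟨⟨hfinSel, hcard'⟩, ?_⟩ hloc h10 h11
  rw [Nat.cast_sub hta, ha]
  push_cast
  ring

/-- **CTL-loc at a CellC datum** (the hypotheses of `X2.SplitControlOnTree` verbatim, plus `E(K)[p] = 0`
and Fin_v): `ControlOnTreeAt` at every CGLS Heegner datum of a split or non-split X2c pair.
[cite: Castella2018, Thm. 2.3 (arXiv:1704.06608 p. 5)] [cite: JetchevSkinnerWan2017, Thm. 3.3.1 (arXiv:1512.06894 p. 11)] -/
theorem controlOnTreeAt_of_cellC_datum_of_noKTorsion_of_finV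
    (hGZK : rank_eq_analyticRank_of_analyticRank_le_one) (hnf : exists_isNewformOf)
    (hPT : ∀ (K : Type) [Field K] [NumberField K], poitouTate_selmerStructure_duality K)
    (hPT2 : ∀ (K : Type) [Field K] [NumberField K], poitouTate_sha_tateDual K)
    (hEP : ∀ (K : Type) [Field K] [NumberField K] (v : HeightOneSpectrum (𝓞 K)),
      localEulerPoincareCharacteristic (v.adicCompletion K))
    (hBr : ∀ (K : Type) [Field K] [NumberField K] (p : ℕ) [Fact p.Prime],
      ZpExtension.decomp_not_le_kerSubgroup_of_isAnticyclotomic K p)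
    (hp2 : p ≠ 2) (hc : CellC W p)
    {K : Type} [Field K] [NumberField K] (hK : IsImaginaryQuadratic K)
    (hHp : SatisfiesHeegnerHypothesis p K)
    (hivK0 : ∀ Q : (W.baseChange K).toAffine.Point, p • Q = 0 → Q = 0)
    (hLt : (W.quadraticTwist (NumberField.discr K : ℚ)).entireLFunction 1 ≠ 0)
    (P : (W.baseChange K).toAffine.Point) (hPinf : ¬ IsOfFinAddOrder P)
    (κ : ZpExtension K p) (hκ : κ.IsAnticyclotomic) (γ : absoluteGaloisGroup K)
    [Fact (κ.IsTopGenerator γ)] (𝔭 : HeightOneSpectrum (𝓞 K))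
    (h𝔭 : ((p : ℕ) : 𝓞 K) ∈ 𝔭.asIdeal) (he : 𝔭.asIdeal.ramificationIdx (𝓞 ℚ) = 1)
    (hf : 𝔭.asIdeal.inertiaDeg (𝓞 ℚ) = 1)
    (hFin : LocalTowerTorsionFiniteAt (W.baseChange K) p κ 𝔭) :
    ControlOnTreeAt p κ 𝔭 γ (embAt K p 𝔭 h𝔭 he hf) P :=
  controlOnTreeAt_of_cellC_of_noKTorsion_of_finV W p hGZK hnf hPT hPT2 hEP hBr hp2 hc.2.2.2 hc.1 hK
    (hHp p Fact.out dvd_rfl) hivK0 hLt P hPinf κ hκ γ 𝔭 h𝔭 he hf hFin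

end Datum

/-! ## §4. `SplitControlOnTree` from `E(K)[p] = 0` at every CGLS field and Fin_v at every frame -/

section Split

variable (W : WeierstrassCurve ℚ) [W.IsElliptic] [W.IsGloballyMinimal] (p : ℕ) [Fact p.Prime]

/-- **CTL-split WITH local `p`-torsion, from `E(K)[p] = 0` and Fin_v.** For a rank-one X2 pair `(E, p)`
(`CellC W p`), `p` odd: IF `E(K)[p] = 0` for every imaginary quadratic `K` in which `p` splits (at the
END of the ℚ-rational étale `p`-isogeny chain this is the THEOREM
`EtaleChainEnd.forall_torsion_eq_zero_of_no_etaleLine_of_odd`, k5-c4 g4) and IF Fin_v holds at every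
anticyclotomic frame `(K, κ, 𝔭)` (`E(K_{∞,w})[p^∞]` finite — the next file of this seat at a split
multiplicative `p`), THEN `X2.SplitControlOnTree W p`, from GZK / modularity and the cited
cohomological facts. NO hypothesis `E(ℚ_p)[p] = 0`: the torsion residual of `stub_ctlOrSwitch`
(cgshw MEMO-11: the 14/543 window classes @3 with no étale switch) is reduced to Fin_v.
CONDITIONAL on the cited facts; nothing booked.
[cite: Castella2018, Thm. 2.3 (arXiv:1704.06608 p. 5)] [cite: JetchevSkinnerWan2017, Thm. 3.3.1, Prop. 3.3.4 Case 3(b) (arXiv:1512.06894 pp. 11–13)]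
[cite: KellerYin2024, App. B Thm. B.0.6 (printed template: control with torsion)] -/
theorem splitControlOnTree_of_cellC_of_noKTorsion_of_finV
    (hGZK : rank_eq_analyticRank_of_analyticRank_le_one) (hnf : exists_isNewformOf)
    (hPT : ∀ (K : Type) [Field K] [NumberField K], poitouTate_selmerStructure_duality K)
    (hPT2 : ∀ (K : Type) [Field K] [NumberField K], poitouTate_sha_tateDual K)
    (hEP : ∀ (K : Type) [Field K] [NumberField K] (v : HeightOneSpectrum (𝓞 K)),
      localEulerPoincareCharacteristic (v.adicCompletion K))
    (hBr : ∀ (K : Type) [Field K] [NumberField K] (p : ℕ) [Fact p.Prime],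
      ZpExtension.decomp_not_le_kerSubgroup_of_isAnticyclotomic K p)
    (hp2 : p ≠ 2) (hc : CellC W p)
    (hivK : ∀ (K : Type) [Field K] [NumberField K], IsImaginaryQuadratic K → SplitsIn K p →
      ∀ Q : (W.baseChange K).toAffine.Point, p • Q = 0 → Q = 0)
    (hFin : ∀ (K : Type) [Field K] [NumberField K], IsImaginaryQuadratic K → SplitsIn K p →
      ∀ (κ : ZpExtension K p), κ.IsAnticyclotomic → ∀ (𝔭 : HeightOneSpectrum (𝓞 K)),
        ((p : ℕ) : 𝓞 K) ∈ 𝔭.asIdeal → LocalTowerTorsionFiniteAt (W.baseChange K) p κ 𝔭) :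
    X2.SplitControlOnTree W p := by
  intro K _ _ P _ _ hK hHp hLt hPinf κ hκ γ _ 𝔭 h𝔭 he hf
  have hsplit : SplitsIn K p := hHp p Fact.out dvd_rfl
  exact controlOnTreeAt_of_cellC_datum_of_noKTorsion_of_finV W p hGZK hnf hPT hPT2 hEP hBr hp2 hc hK
    hHp (hivK K hK hsplit) hLt P hPinf κ hκ γ 𝔭 h𝔭 he hf (hFin K hK hsplit κ hκ 𝔭 h𝔭)

end Split

end Summit.BirchSwinnertonDyer.BirchSwinnertonDyer.Theorems.CtlLoc

end
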